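import Mathlib.RingTheory.Polynomial.Vieta
import Mathlib.Algebra.Polynomial.BigOperators
import Mathlib.Algebra.Polynomial.Roots
import Literature.NumberTheory.Automorphic.HarishChandraGLExistence
import Literature.NumberTheory.Automorphic.HarishChandraGLIsomorphism
import Literature.NumberTheory.Automorphic.AutomorphicRepsGL
import HarnessLib

/-!
# Uniqueness of Harish-Chandra parameters and of archimedean parameters / infinity types

Topic `NumberTheory/Automorphic`; theorems only (no definition, no named fact), supporting the
named fact `Henniart2012_infinityType_of_automorphicInduction` of
`HenniartAutomorphicInduction` (whose conclusion is quantified over *all* infinity types of the two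
representations) and discharging the uniqueness hypothesis `huniq` that
`ArthurClozel1989_strongLifting_archimedean.isLAlgebraic_descent` (`BaseChangeArchimedean`) takes.

* `HasHCParameter.unique` — a `𝔤𝔩ₙ(𝕜)`-module (`𝕜 = ℝ` or `ℂ`) on a **non-zero** complex vector
  space has at most one Harish-Chandra parameter `χ : (𝕜 →ₐ[ℝ] ℂ) → Multiset ℂ` (accepted
  `HasHCParameter` of `HarishChandraGL`). Proof: the infinitesimal character `θ` is determined by
  the module (`V ≠ 0`); by Harish-Chandra's theorem, PROVED in the tree — existence of the
  Harish-Chandra homomorphism `γ` (`harishChandraHomGL`, file `HarishChandraGLExistence`) and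
  `range γ_ℂ = ℂ[x_{τ,i}]^{∏_τ 𝔖ₙ}` (`HarishChandraHomGL.baseChange_injective_and_range_eq`, file
  `HarishChandraGLIsomorphism`) — `θ` determines the value at `χ` of every `τ`-wise symmetric
  polynomial, in particular of the elementary symmetric polynomials of each block of variables
  `x_{τ,1}, …, x_{τ,n}`, hence (Vieta) each multiset `χ τ`. Knapp, *Lie Groups Beyond an
  Introduction* (2002), Thm. 5.44 and Prop. 5.32 ff. (`χ_λ = χ_{λ'}` iff `λ' ∈ W λ`); Humphreys
  (1972), §23.3.
* `AutomorphicRepData.nontrivial_quot` — `W / W' ≠ 0` for an automorphic representation datum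
  (`W' < W`).
* `AutomorphicRepData.hasArchParameter_unique` — an automorphic representation of `GL_n(𝔸_K)`
  (Borel–Jacquet datum, `AutomorphicRepsGL`) has at most one archimedean parameter
  `χ : (K →+* ℂ) → Multiset ℂ`: the Lie algebra action on `W / W'` is unique
  (`hasLieAction_unique`), every complex embedding `σ` of `K` is `w.embedding` for the real place
  `w = mk σ`, or one of `w.embedding`, `conj ∘ w.embedding` for the complex place `w = mk σ`
  (Mathlib `NumberField.InfinitePlace.mk_eq_iff`), and the place-by-place parameters are unique.
  Clozel 1990, §3.3; Borel–Jacquet 1979, 4.6.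
* `AutomorphicRepData.HasInfinityType.map_a_eq` — two infinity types of the same `π` have the same
  multisets of `z`-exponents at every embedding (the pairing `(a_i, b_i)` is not determined, the
  multisets are; Clozel 1990, §3.3), and `….map_b_eq` for the `z̄`-exponents.

## References

* A. W. Knapp, *Lie Groups Beyond an Introduction*, 2nd ed., Birkhäuser 2002, §V.5, Thm. 5.44.
* J. E. Humphreys, *Introduction to Lie Algebras and Representation Theory*, GTM 9, 1972, §23.3.
* L. Clozel, *Motifs et formes automorphes*, in: Automorphic forms, Shimura varieties, and
  L-functions I (1990), §3.3.
* A. Borel, H. Jacquet, *Automorphic forms and automorphic representations*, Corvallis 1979, 4.6.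
-/

-- Mathlib idiom (Mathlib/Algebra/Lie/OfAssociative.lean); needed to mention Lie subalgebras of matrix algebras
attribute [local instance 100] LieRing.ofAssociativeRing

open scoped TensorProduct Polynomial Classical
open NumberField NumberField.InfinitePlace NumberField.mixedEmbedding Polynomial

noncomputable section

namespace Literature.NumberTheory.Automorphic

/-! ### Two elementary lemmas on multisets -/

section Multiset

/-- A multiset with `n` elements is the image of `Finset.univ : Finset (Fin n)` under some
enumeration `Fin n → α` (a private copy of `exists_univ_val_map_eq` of `ShintaniWhittakerFormula`,
not imported to keep this file light). [folklore] -/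
private theorem exists_enum_of_card_eq {α : Type*} {n : ℕ} (s : Multiset α) (hs : Multiset.card s = n) :
    ∃ l : Fin n → α, Finset.univ.val.map l = s := by
  induction s using Quotient.inductionOn with
  | h L =>
    have hL : L.length = n := by simpa using hs
    subst hL
    exact ⟨L.get, by rw [Fin.univ_val_map, List.ofFn_get]; rfl⟩

/-- **Vieta / Newton**: two multisets over an integral domain with the same number of elements and
the same elementary symmetric functions are equal (both are the roots of `∏ (X - a)`, whose
coefficients are the signed elementary symmetric functions). [folklore] -/
theorem multiset_eq_of_forall_esymm_eq {R : Type*} [CommRing R] [IsDomain R] {s t : Multiset R}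
    (hcard : Multiset.card s = Multiset.card t)
    (h : ∀ k ≤ Multiset.card s, s.esymm k = t.esymm k) : s = t := by
  have hp : (s.map fun a => X - C a).prod = (t.map fun a => X - C a).prod := by
    apply Polynomial.ext
    intro k
    by_cases hk : k ≤ Multiset.card s
    · rw [Multiset.prod_X_sub_C_coeff s hk, Multiset.prod_X_sub_C_coeff t (hcard ▸ hk), ← hcard,
        h _ (Nat.sub_le _ _)]
    · replace hk := not_le.mp hk
      rw [coeff_eq_zero_of_natDegree_lt, coeff_eq_zero_of_natDegree_lt]
      · rw [natDegree_multiset_prod_X_sub_C_eq_card]; omega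
      · rw [natDegree_multiset_prod_X_sub_C_eq_card]; omega
  rw [← roots_multiset_prod_X_sub_C s, hp, roots_multiset_prod_X_sub_C]

end Multiset

/-! ### Uniqueness of the Harish-Chandra parameter of a `𝔤𝔩ₙ(𝕜)`-module -/

section HC

variable {𝕜 : Type*} [RCLike 𝕜] {n : ℕ} {V : Type*} [AddCommGroup V] [Module ℂ V]
  (ρ𝔤 : Matrix (Fin n) (Fin n) 𝕜 →ₗ⁅ℝ⁆ Module.End ℂ V)

/-- The block elementary symmetric polynomial `e_k(x_{τ,1}, …, x_{τ,n})` is `∏_τ 𝔖ₙ`-symmetric.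
Knapp 2002, §V.5. [folklore] -/
theorem rename_prodMk_esymm_mem_symmetricSubalgebraGL (τ : 𝕜 →ₐ[ℝ] ℂ) (k : ℕ) :
    MvPolynomial.rename (Prod.mk τ) (MvPolynomial.esymm (Fin n) ℂ k) ∈ symmetricSubalgebraGL 𝕜 n := by
  intro σ
  rw [MvPolynomial.rename_rename,
    show (Equiv.prodCongrRight σ) ∘ (Prod.mk τ) = (Prod.mk τ : Fin n → (𝕜 →ₐ[ℝ] ℂ) × Fin n) ∘ (σ τ)
      from rfl, ← MvPolynomial.rename_rename, MvPolynomial.rename_esymm]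

/-- On a non-zero module the infinitesimal (central) character is unique. Knapp–Vogan, §I.4.
[folklore] -/
theorem HasCentralCharacter.unique [Nontrivial V]
    {θ θ' : Subalgebra.center ℝ (UniversalEnvelopingAlgebra ℝ (Matrix (Fin n) (Fin n) 𝕜)) →ₐ[ℝ] ℂ}
    (h : HasCentralCharacter ρ𝔤 θ) (h' : HasCentralCharacter ρ𝔤 θ') : θ = θ' := by
  refine AlgHom.ext fun z => ?_
  obtain ⟨v, hv⟩ := exists_ne (0 : V)
  have e := congrArg (fun T : Module.End ℂ V => T v) ((h z).symm.trans (h' z))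
  simp only [Module.algebraMap_end_apply] at e
  exact smul_left_injective ℂ hv e

/-- **Uniqueness of Harish-Chandra parameters.** A `𝔤𝔩ₙ(𝕜)`-module (`𝕜 = ℝ` or `ℂ`, `𝔤𝔩ₙ(𝕜)` as
a real Lie algebra) on a non-zero complex vector space has at most one Harish-Chandra parameter
(`HasHCParameter`): the infinitesimal character determines, through the Harish-Chandra
homomorphism `γ` (which exists, `harishChandraHomGL`) the values at the parameter of all of
`range γ_ℂ = ℂ[x_{τ,i}]^{∏_τ 𝔖ₙ}` (`HarishChandraHomGL.baseChange_injective_and_range_eq`), in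
particular of the block elementary symmetric polynomials, which determine each multiset `χ τ`
(Vieta). Knapp 2002, Thm. 5.44 (with Prop. 5.32: `χ_λ = χ_{λ'} ↔ λ' ∈ W λ`); Humphreys 1972,
§23.3. [cite: Knapp2002, §V.5 Thm. 5.44] -/
theorem HasHCParameter.unique [Nontrivial V] {χ χ' : (𝕜 →ₐ[ℝ] ℂ) → Multiset ℂ}
    (h : HasHCParameter ρ𝔤 χ) (h' : HasHCParameter ρ𝔤 χ') : χ = χ' := by
  obtain ⟨hcard, θ, hθ, hχ⟩ := h
  obtain ⟨hcard', θ', hθ', hχ'⟩ := h'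
  obtain rfl : θ = θ' := HasCentralCharacter.unique ρ𝔤 hθ hθ'
  choose l hl using fun τ => exists_enum_of_card_eq (χ τ) (hcard τ)
  choose l' hl' using fun τ => exists_enum_of_card_eq (χ' τ) (hcard' τ)
  set γ : HarishChandraHomGL 𝕜 n := harishChandraHomGL 𝕜 n
  -- the two evaluations agree on `γ(Z(𝔤))` …
  have hz : ∀ z, MvPolynomial.aeval (fun p : (𝕜 →ₐ[ℝ] ℂ) × Fin n => l p.1 p.2) (γ.toAlgHom z) =
      MvPolynomial.aeval (fun p : (𝕜 →ₐ[ℝ] ℂ) × Fin n => l' p.1 p.2) (γ.toAlgHom z) := fun z => by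
    rw [← hχ γ l hl z, ← hχ' γ l' hl' z]
  -- … hence on `γ_ℂ(ℂ ⊗ Z(𝔤))` …
  have hbc : ∀ ζ, MvPolynomial.aeval (fun p : (𝕜 →ₐ[ℝ] ℂ) × Fin n => l p.1 p.2) (γ.baseChange ζ) =
      MvPolynomial.aeval (fun p : (𝕜 →ₐ[ℝ] ℂ) × Fin n => l' p.1 p.2) (γ.baseChange ζ) := by
    intro ζ
    induction ζ using TensorProduct.induction_on with
    | zero => simp
    | tmul c z => simp only [HarishChandraHomGL.baseChange_tmul, map_smul, hz]
    | add x y hx hy => simp only [map_add, hx, hy]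
  -- … which is all of the symmetric polynomials (Harish-Chandra's isomorphism)
  have hsymm : ∀ q ∈ symmetricSubalgebraGL 𝕜 n,
      MvPolynomial.aeval (fun p : (𝕜 →ₐ[ℝ] ℂ) × Fin n => l p.1 p.2) q =
        MvPolynomial.aeval (fun p : (𝕜 →ₐ[ℝ] ℂ) × Fin n => l' p.1 p.2) q := by
    intro q hq
    rw [← (HarishChandraHomGL.baseChange_injective_and_range_eq γ).2] at hq
    obtain ⟨ζ, rfl⟩ := (AlgHom.mem_range _).mp hq
    exact hbc ζ
  funext τ
  refine multiset_eq_of_forall_esymm_eq (by rw [hcard, hcard']) fun k _ => ?_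
  have e := hsymm _ (rename_prodMk_esymm_mem_symmetricSubalgebraGL τ k)
  rw [MvPolynomial.aeval_rename, MvPolynomial.aeval_rename] at e
  change MvPolynomial.aeval (l τ) _ = MvPolynomial.aeval (l' τ) _ at e
  rwa [MvPolynomial.aeval_esymm_eq_multiset_esymm, MvPolynomial.aeval_esymm_eq_multiset_esymm,
    hl, hl'] at e

/-- The infinitesimal character of a module with Harish-Chandra parameter `χ` is evaluation at (any
enumeration of) `χ` through *the* Harish-Chandra homomorphism `harishChandraHomGL`.
Knapp 2002, Thm. 5.44. [cite: Knapp2002, §V.5 Thm. 5.44] -/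
theorem HasHCParameter.hasCentralCharacter_aeval {χ : (𝕜 →ₐ[ℝ] ℂ) → Multiset ℂ}
    (h : HasHCParameter ρ𝔤 χ) (l : (𝕜 →ₐ[ℝ] ℂ) → Fin n → ℂ)
    (hl : ∀ τ, Finset.univ.val.map (l τ) = χ τ) :
    ∃ θ : Subalgebra.center ℝ (UniversalEnvelopingAlgebra ℝ (Matrix (Fin n) (Fin n) 𝕜)) →ₐ[ℝ] ℂ,
      HasCentralCharacter ρ𝔤 θ ∧ ∀ z, θ z =
        MvPolynomial.aeval (fun p : (𝕜 →ₐ[ℝ] ℂ) × Fin n => l p.1 p.2)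
          ((harishChandraHomGL 𝕜 n).toAlgHom z) := by
  obtain ⟨-, θ, hθ, hχ⟩ := h
  exact ⟨θ, hθ, hχ _ l hl⟩

end HC

/-! ### Archimedean parameters and infinity types of automorphic representations of `GL_n` -/

section Arch

variable {K : Type} [Field K] [NumberField K]

section General

variable {A : Type*} [NormedCommRing A] [NormedAlgebra ℝ A] [NormedAlgebra ℚ A] [CompleteSpace A]
  [StarRing A] {N : Type*} [Fintype N] [DecidableEq N]
  {𝒢 : AdelicGroupData K} {𝒟 : AutomorphyDatum 𝒢 A N} (π : AutomorphicRepData 𝒟)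

/-- The representation space `W / W'` of an automorphic representation datum is non-zero
(`W' < W`). Borel–Jacquet 1979, 4.6. [cite: BorelJacquet1979, 4.6] -/
theorem AutomorphicRepData.nontrivial_quot : Nontrivial π.Quot := by
  rw [AutomorphicRepData.Quot, Submodule.Quotient.nontrivial_iff]
  intro htop
  obtain ⟨φ, hφW, hφW'⟩ := SetLike.exists_of_lt π.lt
  have hmem : (⟨φ, hφW⟩ : π.W) ∈ π.kerQuot := htop ▸ Submodule.mem_top
  exact hφW' (by simpa [AutomorphicRepData.kerQuot] using hmem)

end General

variable {n : ℕ} {hcpt : isCompact_glFiniteIntegralLevel n K}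
  (π : AutomorphicRepData (AutomorphyDatum.gl n K hcpt))

omit [NumberField K] in
/-- `conj ∘ φ`, written with the real algebra automorphism `conj` of `ℂ`, is the conjugate
embedding. [folklore] -/
theorem conjAe_toRingHom_comp (φ : K →+* ℂ) :
    (Complex.conjAe : ℂ →ₐ[ℝ] ℂ).toRingHom.comp φ = ComplexEmbedding.conjugate φ :=
  RingHom.ext fun x => by simp [ComplexEmbedding.conjugate_coe_eq]

omit [NumberField K] in
/-- `id ∘ φ = φ` for the identity real algebra map of `ℂ`. [folklore] -/
theorem algHomId_toRingHom_comp (φ : K →+* ℂ) :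
    (AlgHom.id ℝ ℂ).toRingHom.comp φ = φ :=
  RingHom.ext fun _ => rfl

/-- **Uniqueness of the archimedean parameter of an automorphic representation of `GL_n(𝔸_K)`.**
If `π = W / W'` has archimedean parameters `χ` and `χ'` (`AutomorphicRepData.HasArchParameter`:
Harish-Chandra parameters, place by place, of the Lie algebra action on `W / W'`), then `χ = χ'`.
The Lie algebra action is unique (`hasLieAction_unique`), `W / W' ≠ 0` (`nontrivial_quot`), the
parameters at each real and complex place are unique (`HasHCParameter.unique`, Harish-Chandra),
and every `σ : K →+* ℂ` is `w.embedding` for the real place `w = mk σ` or one of `w.embedding`,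
`conj ∘ w.embedding` for the complex place `w = mk σ`. Clozel 1990, §3.3 (the infinitesimal
character of `π_∞` determines `(p_i)` at each `σ`); Knapp 2002, Thm. 5.44.
[cite: Clozel1990, §3.3] -/
theorem AutomorphicRepData.hasArchParameter_unique {χ χ' : (K →+* ℂ) → Multiset ℂ}
    (h : π.HasArchParameter χ) (h' : π.HasArchParameter χ') : χ = χ' := by
  obtain ⟨ρ, hρ, hχ⟩ := h
  obtain ⟨ρ', hρ', hχ'⟩ := h'
  obtain rfl : ρ = ρ' := π.hasLieAction_unique hρ hρ'
  haveI : Nontrivial π.Quot := π.nontrivial_quot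
  funext σ
  rcases (InfinitePlace.mk σ).isReal_or_isComplex with hw | hw
  · -- real place: `σ = (mk σ).embedding`
    have e := congr_fun (HasHCParameter.unique _ (hχ.1 ⟨InfinitePlace.mk σ, hw⟩) (hχ'.1 ⟨InfinitePlace.mk σ, hw⟩))
      (Algebra.ofId ℝ ℂ)
    dsimp only at e
    rwa [embedding_mk_eq_of_isReal (isReal_mk_iff.mp hw)] at e
  · -- complex place: `σ ∈ {w.embedding, conj ∘ w.embedding}`, `w = mk σ`
    have e := HasHCParameter.unique _ (hχ.2 ⟨InfinitePlace.mk σ, hw⟩) (hχ'.2 ⟨InfinitePlace.mk σ, hw⟩)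
    rcases InfinitePlace.mk_eq_iff.mp (InfinitePlace.mk_embedding (InfinitePlace.mk σ)) with hσ | hσ
    · have e₁ := congr_fun e (AlgHom.id ℝ ℂ)
      dsimp only at e₁
      rwa [algHomId_toRingHom_comp, hσ] at e₁
    · have e₁ := congr_fun e (Complex.conjAe : ℂ →ₐ[ℝ] ℂ)
      dsimp only at e₁
      rwa [conjAe_toRingHom_comp, hσ] at e₁

/-- **The multisets of `z`-exponents of an infinity type are determined by `π`**: two infinity
types `T`, `T'` of the same automorphic representation `π` of `GL_n(𝔸_K)` have the same multiset
`{a_i}` at every complex embedding (the pairing `(a_i, b_i)` need not agree). Clozel 1990, §3.3.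
[cite: Clozel1990, §3.3] -/
theorem AutomorphicRepData.HasInfinityType.map_a_eq {T T' : InfinityType K n}
    (hT : π.HasInfinityType T) (hT' : π.HasInfinityType T') (σ : K →+* ℂ) :
    (T σ).map ArchWeight.a = (T' σ).map ArchWeight.a :=
  congr_fun (π.hasArchParameter_unique hT.2 hT'.2) σ

/-- Likewise for the multisets `{b_i}` of `z̄`-exponents (`{b_i at σ} = {a_i at σ̄}` for a
well-formed type). Clozel 1990, §3.3. [cite: Clozel1990, §3.3] -/
theorem AutomorphicRepData.HasInfinityType.map_b_eq {T T' : InfinityType K n}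
    (hT : π.HasInfinityType T) (hT' : π.HasInfinityType T') (σ : K →+* ℂ) :
    (T σ).map ArchWeight.b = (T' σ).map ArchWeight.b := by
  have ha := AutomorphicRepData.HasInfinityType.map_a_eq π hT hT' (ComplexEmbedding.conjugate σ)
  rw [hT.1.2 σ, hT'.1.2 σ, Multiset.map_map, Multiset.map_map] at ha
  simpa using ha

/-- An automorphic representation with an infinity type has exactly one archimedean parameter,
namely the `a`-multisets of any of its infinity types. Clozel 1990, §3.3. [cite: Clozel1990, §3.3] -/
theorem AutomorphicRepData.HasInfinityType.hasArchParameter_iff {T : InfinityType K n}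
    (hT : π.HasInfinityType T) (χ : (K →+* ℂ) → Multiset ℂ) :
    π.HasArchParameter χ ↔ χ = fun σ => (T σ).map ArchWeight.a :=
  ⟨fun h => π.hasArchParameter_unique h hT.2, fun h => h ▸ hT.2⟩

end Arch

end Literature.NumberTheory.Automorphic
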